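import Mathlib
import HarnessLib

/-!
# Elementary conditional kernels on countable probability spaces (the lattice tensor identity, generically)

Crux `AxiomsOfLimit` (stmt-CriticalPhenomena-1370), line `registered` (= `split`), stub `stub_markovOfLimit`: Markov passage,
part 4 (lead c3). Generic tool (theorems only).

Hypothesis (b) of `AxiomsOfLimitMarkov.markov_clause_of_lattice_passage` (part 3) asks, at each mesh, for a sub-probability
kernel `κs n` carried by a measurable good set `K n ∋ X n` a.s. such that `∫ f(X n) g(Y n) dP n = ∫ f(X n) (∫ g dκs n (X n)) dP n`.
On the lattice the sample space (self-avoiding walks of `Ω_δ`) is COUNTABLE with the discrete σ-algebra, and for ANY pair of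
random variables `X, Y` on a countable discrete probability space the ELEMENTARY conditional law
`κ x = P(X = x)⁻¹ · (P|_{X = x}) ∘ Y⁻¹` (and `0` off the atoms of the law of `X`) does the job — no model-specific identity is
needed for (b); the exact SAW identity (tree `…ExcursionDomination.law_prefix_restrict`) is only needed later, to IDENTIFY
`κ x` with the critical chord law of the slit graph when proving tip stability (hypothesis (c)).

* `exists_elementary_condKernel` — for `P` a probability measure on a countable space with measurable singletons and any
  `X : Ω → A` (`A` with measurable singletons), `Y : Ω → B`: there are a kernel `κ : Kernel A B` and a countable measurable
  `K ⊆ A` with `κ a univ ≤ 1`, `X ∈ K` a.s., `κ a = P(X⁻¹{a})⁻¹ • (P|_{X⁻¹{a}}).map Y` on `K` (atoms), `κ a = 0` off `K`, and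
  the tensor identity `∫ f(X) g(Y) dP = ∫ f(X) (∫ g dκ(X)) dP` for all real bounded continuous `f, g`.

References: O. Kallenberg, *Foundations of Modern Probability*, 2nd ed. (2002), Ch. 6 (elementary conditional distributions);
P. Billingsley, *Probability and Measure*, 3rd ed. (1995), §33. All [folklore].
-/

noncomputable section

open MeasureTheory ProbabilityTheory Filter Topology Set BoundedContinuousFunction
open scoped NNReal ENNReal

namespace Summit.CriticalPhenomena.SAWScalingLimit.Theorems.AxiomsOfLimitMarkov

section Countable

variable {Ω A B : Type*} [MeasurableSpace Ω] [Countable Ω] [MeasurableSingletonClass Ω]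
  [MeasurableSpace A] [MeasurableSingletonClass A] [TopologicalSpace A]
  [MeasurableSpace B] [TopologicalSpace B] [OpensMeasurableSpace B]

omit [Countable Ω] [MeasurableSingletonClass Ω] [MeasurableSpace A] [MeasurableSingletonClass A] [TopologicalSpace A]
  [TopologicalSpace B] [OpensMeasurableSpace B] in
/-- The elementary conditional law of `Y` on an atom `{X = a}` of positive finite mass is a probability measure. [folklore] -/
theorem elementaryCond_univ (P : Measure Ω) [IsFiniteMeasure P] {X : Ω → A} {Y : Ω → B} (hY : Measurable Y) {a : A}
    (h0 : P (X ⁻¹' {a}) ≠ 0) :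
    ((P (X ⁻¹' {a}))⁻¹ • (P.restrict (X ⁻¹' {a})).map Y) univ = 1 := by
  rw [Measure.smul_apply, Measure.map_apply hY MeasurableSet.univ, preimage_univ, Measure.restrict_apply_univ,
    smul_eq_mul, ENNReal.inv_mul_cancel h0 (measure_ne_top _ _)]

/-- **Elementary conditional kernels on a countable probability space.** For a probability measure `P` on a countable space
with measurable singletons and ANY maps `X : Ω → A` (measurable singletons in `A`), `Y : Ω → B`, the elementary conditional
law `κ a = P(X = a)⁻¹ · (P|_{X = a}) ∘ Y⁻¹` on the (countably many) atoms `a` of the law of `X`, extended by `0`, is a kernel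
with `κ a univ ≤ 1`, carried by the countable measurable atom set `K ∋ X` a.s., and it satisfies the tensor (disintegration)
identity `∫ f(X) g(Y) dP = ∫ f(X) (∫ g dκ(X)) dP` for all real bounded continuous `f, g` (Kallenberg 2002, Ch. 6). This
discharges hypothesis (b) of `markov_clause_of_lattice_passage` for every lattice law. [folklore] -/
theorem exists_elementary_condKernel (P : Measure Ω) [IsProbabilityMeasure P] (X : Ω → A) (Y : Ω → B) :
    ∃ (κ : Kernel A B) (K : Set A), (∀ a, κ a univ ≤ 1) ∧ K.Countable ∧ MeasurableSet K ∧ (∀ᵐ ω ∂P, X ω ∈ K) ∧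
      (∀ a ∈ K, P (X ⁻¹' {a}) ≠ 0 ∧ κ a = (P (X ⁻¹' {a}))⁻¹ • (P.restrict (X ⁻¹' {a})).map Y) ∧
      (∀ a ∉ K, κ a = 0) ∧
      ∀ (f : A →ᵇ ℝ) (g : B →ᵇ ℝ),
        ∫ ω, f (X ω) * g (Y ω) ∂P = ∫ ω, f (X ω) * (∫ b, g b ∂(κ (X ω))) ∂P := by
  classical
  have hXm : Measurable X := measurable_of_countable X
  have hYm : Measurable Y := measurable_of_countable Y
  -- the atoms of the law of `X`
  set K : Set A := {a | P (X ⁻¹' {a}) ≠ 0} with hK_def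
  have hKrange : K ⊆ range X := by
    intro a ha
    by_contra hna
    apply ha
    have : X ⁻¹' {a} = ∅ := by
      ext ω
      simp only [mem_preimage, mem_singleton_iff, mem_empty_iff_false, iff_false]
      exact fun h => hna ⟨ω, h⟩
    rw [this, measure_empty]
  have hKc : K.Countable := (countable_range X).mono hKrange
  have hKm : MeasurableSet K := hKc.measurableSet
  haveI : Countable K := hKc.to_subtype
  -- the elementary conditional laws and the kernel
  set ν : A → Measure B := fun a => (P (X ⁻¹' {a}))⁻¹ • (P.restrict (X ⁻¹' {a})).map Y with hν_def
  set κ : Kernel A B :=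
    Kernel.sum fun s : K => Kernel.piecewise (measurableSet_singleton (s : A)) (Kernel.const A (ν s)) 0 with hκ_def
  have hκ_mem : ∀ a ∈ K, κ a = ν a := by
    intro a ha
    refine Measure.ext fun T hT => ?_
    rw [hκ_def, Kernel.sum_apply, Measure.sum_apply _ hT, tsum_eq_single ⟨a, ha⟩]
    · simp [Kernel.piecewise_apply]
    · rintro ⟨a', ha'⟩ hne
      have hne' : a ≠ a' := fun h => hne (Subtype.ext h.symm)
      simp [Kernel.piecewise_apply, hne']
  have hκ_nmem : ∀ a ∉ K, κ a = 0 := by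
    intro a ha
    refine Measure.ext fun T hT => ?_
    rw [hκ_def, Kernel.sum_apply, Measure.sum_apply _ hT]
    have : ∀ s : K, (Kernel.piecewise (measurableSet_singleton (s : A)) (Kernel.const A (ν s)) 0) a T = 0 := by
      rintro ⟨a', ha'⟩
      have hne : a ≠ a' := fun h => ha (h ▸ ha')
      simp [Kernel.piecewise_apply, hne]
    simp [this]
  refine ⟨κ, K, ?_, hKc, hKm, ?_, fun a ha => ⟨ha, hκ_mem a ha⟩, hκ_nmem, ?_⟩
  · -- sub-probability
    intro a
    by_cases ha : a ∈ K
    · rw [hκ_mem a ha, hν_def]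
      exact (elementaryCond_univ P hYm ha).le
    · rw [hκ_nmem a ha]; simp
  · -- `X ∈ K` almost surely: the bad set is a countable union of null atoms
    rw [ae_iff]
    have hsub : {ω | ¬X ω ∈ K} ⊆ ⋃ a ∈ (range X \ K), X ⁻¹' {a} := by
      intro ω hω
      simp only [mem_iUnion, mem_preimage, mem_singleton_iff, exists_prop, Set.mem_sdiff, mem_range]
      exact ⟨X ω, ⟨⟨ω, rfl⟩, hω⟩, rfl⟩
    refine measure_mono_null hsub ?_
    refine (measure_biUnion_null_iff ((countable_range X).mono sdiff_subset)).2 ?_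
    intro a ha
    have : ¬ P (X ⁻¹' {a}) ≠ 0 := ha.2
    exact not_not.1 this
  · -- the tensor identity, fibre by fibre
    intro f g
    -- decomposition of `P` along the atoms
    have hdisj : Pairwise (Function.onFun Disjoint fun s : K => X ⁻¹' ({(s : A)} : Set A)) := by
      rintro ⟨a, ha⟩ ⟨a', ha'⟩ hne
      have hne' : a ≠ a' := fun h => hne (Subtype.ext h)
      exact Disjoint.preimage X (disjoint_singleton.2 hne')
    have hfib : ∀ s : K, MeasurableSet (X ⁻¹' ({(s : A)} : Set A)) := fun s => hXm (measurableSet_singleton _)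
    have hae : ∀ᵐ ω ∂P, ω ∈ ⋃ s : K, X ⁻¹' ({(s : A)} : Set A) := by
      have hK' : ∀ᵐ ω ∂P, X ω ∈ K := by
        rw [ae_iff]
        have hsub : {ω | ¬X ω ∈ K} ⊆ ⋃ a ∈ (range X \ K), X ⁻¹' {a} := by
          intro ω hω
          simp only [mem_iUnion, mem_preimage, mem_singleton_iff, exists_prop, Set.mem_sdiff, mem_range]
          exact ⟨X ω, ⟨⟨ω, rfl⟩, hω⟩, rfl⟩
        refine measure_mono_null hsub ((measure_biUnion_null_iff ((countable_range X).mono sdiff_subset)).2 ?_)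
        intro a ha
        exact not_not.1 ha.2
      filter_upwards [hK'] with ω hω
      exact mem_iUnion.2 ⟨⟨X ω, hω⟩, rfl⟩
    have hP : Measure.sum (fun s : K => P.restrict (X ⁻¹' ({(s : A)} : Set A))) = P := by
      rw [← Measure.restrict_iUnion hdisj hfib, Measure.restrict_eq_self_of_ae_mem hae]
    -- integrability of both integrands (bounded, measurable)
    have hmeas_int : Measurable fun a : A => ∫ b, g b ∂(κ a) :=
      (g.continuous.stronglyMeasurable.integral_kernel (κ := κ)).measurable
    have hbd_int : ∀ a, |∫ b, g b ∂(κ a)| ≤ ‖g‖ := by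
      intro a
      have hκa : κ a univ ≤ 1 := by
        by_cases ha : a ∈ K
        · rw [hκ_mem a ha, hν_def]; exact (elementaryCond_univ P hYm ha).le
        · rw [hκ_nmem a ha]; simp
      haveI : IsFiniteMeasure (κ a) := ⟨hκa.trans_lt ENNReal.one_lt_top⟩
      have hreal : (κ a).real univ ≤ 1 := by
        have := ENNReal.toReal_mono ENNReal.one_ne_top hκa
        simpa [Measure.real] using this
      calc |∫ b, g b ∂(κ a)| ≤ ∫ b, |g b| ∂(κ a) := abs_integral_le_integral_abs
        _ ≤ ∫ _, ‖g‖ ∂(κ a) := by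
            refine integral_mono_of_nonneg (Eventually.of_forall fun b => abs_nonneg _) (integrable_const _)
              (Eventually.of_forall fun b => ?_)
            show |g b| ≤ ‖g‖
            rw [← Real.norm_eq_abs]; exact g.norm_coe_le_norm b
        _ = ‖g‖ * (κ a).real univ := by rw [integral_const, smul_eq_mul, mul_comm]
        _ ≤ ‖g‖ * 1 := mul_le_mul_of_nonneg_left hreal (norm_nonneg _)
        _ = ‖g‖ := mul_one _
    have hintL : Integrable (fun ω => f (X ω) * g (Y ω)) P := by
      refine Integrable.of_bound (measurable_of_countable _).aestronglyMeasurable (‖f‖ * ‖g‖)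
        (Eventually.of_forall fun ω => ?_)
      rw [norm_mul]
      exact mul_le_mul (f.norm_coe_le_norm _) (g.norm_coe_le_norm _) (norm_nonneg _) (norm_nonneg _)
    have hintR : Integrable (fun ω => f (X ω) * ∫ b, g b ∂(κ (X ω))) P := by
      refine Integrable.of_bound (measurable_of_countable _).aestronglyMeasurable (‖f‖ * ‖g‖)
        (Eventually.of_forall fun ω => ?_)
      rw [norm_mul, Real.norm_eq_abs (∫ b, g b ∂(κ (X ω)))]
      exact mul_le_mul (f.norm_coe_le_norm _) (hbd_int _) (abs_nonneg _) (norm_nonneg _)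
    -- fibre computations
    have hfibre : ∀ s : K,
        ∫ ω, f (X ω) * g (Y ω) ∂(P.restrict (X ⁻¹' ({(s : A)} : Set A))) =
          ∫ ω, f (X ω) * (∫ b, g b ∂(κ (X ω))) ∂(P.restrict (X ⁻¹' ({(s : A)} : Set A))) := by
      rintro ⟨a, ha⟩
      have h0 : P (X ⁻¹' {a}) ≠ 0 := ha
      have htop : P (X ⁻¹' {a}) ≠ ∞ := measure_ne_top _ _
      -- on the fibre, `X = a`
      have hL : ∫ ω in X ⁻¹' {a}, f (X ω) * g (Y ω) ∂P = f a * ∫ ω in X ⁻¹' {a}, g (Y ω) ∂P := by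
        rw [← integral_const_mul]
        refine setIntegral_congr_fun (hXm (measurableSet_singleton a)) fun ω hω => ?_
        rw [mem_preimage, mem_singleton_iff] at hω
        simp only [hω]
      have hR : ∫ ω in X ⁻¹' {a}, f (X ω) * (∫ b, g b ∂(κ (X ω))) ∂P =
          f a * (∫ b, g b ∂(κ a)) * (P (X ⁻¹' {a})).toReal := by
        have : ∫ ω in X ⁻¹' {a}, f (X ω) * (∫ b, g b ∂(κ (X ω))) ∂P =
            ∫ _ in X ⁻¹' {a}, f a * (∫ b, g b ∂(κ a)) ∂P := by
          refine setIntegral_congr_fun (hXm (measurableSet_singleton a)) fun ω hω => ?_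
          rw [mem_preimage, mem_singleton_iff] at hω
          simp only [hω]
        rw [this, setIntegral_const, smul_eq_mul, mul_comm, Measure.real]
      -- the conditional law integrates `g` to the normalised fibre integral
      have hκa : ∫ b, g b ∂(κ a) = (P (X ⁻¹' {a}))⁻¹.toReal * ∫ ω in X ⁻¹' {a}, g (Y ω) ∂P := by
        rw [hκ_mem a ha, hν_def]
        simp only
        rw [integral_smul_measure, integral_map hYm.aemeasurable g.continuous.aestronglyMeasurable, smul_eq_mul]
      have hcancel : (P (X ⁻¹' {a})).toReal * (P (X ⁻¹' {a}))⁻¹.toReal = 1 := by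
        rw [← ENNReal.toReal_mul, ENNReal.mul_inv_cancel h0 htop, ENNReal.toReal_one]
      simp only at hL hR ⊢
      rw [hL, hR, hκa]
      calc f a * ∫ ω in X ⁻¹' {a}, g (Y ω) ∂P
          = f a * ((P (X ⁻¹' {a})).toReal * (P (X ⁻¹' {a}))⁻¹.toReal) * ∫ ω in X ⁻¹' {a}, g (Y ω) ∂P := by
            rw [hcancel, mul_one]
        _ = f a * ((P (X ⁻¹' {a}))⁻¹.toReal * ∫ ω in X ⁻¹' {a}, g (Y ω) ∂P) * (P (X ⁻¹' {a})).toReal := by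
            ring
    -- assemble
    have hL' : ∫ ω, f (X ω) * g (Y ω) ∂P =
        ∑' s : K, ∫ ω, f (X ω) * g (Y ω) ∂(P.restrict (X ⁻¹' ({(s : A)} : Set A))) := by
      conv_lhs => rw [← hP]
      exact integral_sum_measure (by rw [hP]; exact hintL)
    have hR' : ∫ ω, f (X ω) * (∫ b, g b ∂(κ (X ω))) ∂P =
        ∑' s : K, ∫ ω, f (X ω) * (∫ b, g b ∂(κ (X ω))) ∂(P.restrict (X ⁻¹' ({(s : A)} : Set A))) := by
      conv_lhs => rw [← hP]
      exact integral_sum_measure (by rw [hP]; exact hintR)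
    rw [hL', hR']
    exact tsum_congr hfibre


/-! ### Registered sub-goal of crux stmt-CriticalPhenomena-1370 (line `registered`, stub `stub_markovOfLimit`) -/

/-- **Registered sub-goal `stub_elementaryCondKernel`** (crux stmt-CriticalPhenomena-1370, Markov passage, part 4):
`exists_elementary_condKernel` with all binders explicit, notation-free, at universe level `0` (the level of
`SAW.DomainSAW …` and `CurveClass ℂ`). [folklore] -/
theorem stub_elementaryCondKernel :
    ∀ (Ω A B : Type) [MeasurableSpace Ω] [Countable Ω] [MeasurableSingletonClass Ω] [MeasurableSpace A] [MeasurableSingletonClass A] [TopologicalSpace A] [MeasurableSpace B] [TopologicalSpace B] [OpensMeasurableSpace B] (P : MeasureTheory.Measure Ω) [MeasureTheory.IsProbabilityMeasure P] (X : Ω → A) (Y : Ω → B), ∃ (κ : ProbabilityTheory.Kernel A B) (K : Set A), (∀ a, κ a Set.univ ≤ 1) ∧ K.Countable ∧ MeasurableSet K ∧ Filter.Eventually (fun ω => X ω ∈ K) (MeasureTheory.ae P) ∧ (∀ a ∈ K, P (X ⁻¹' {a}) ≠ 0 ∧ κ a = (P (X ⁻¹' {a}))⁻¹ • (P.restrict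 (X ⁻¹' {a})).map Y) ∧ (∀ a ∉ K, κ a = 0) ∧ ∀ (f : BoundedContinuousFunction A ℝ) (g : BoundedContinuousFunction B ℝ), MeasureTheory.integral P (fun ω => f (X ω) * g (Y ω)) = MeasureTheory.integral P (fun ω => f (X ω) * MeasureTheory.integral (κ (X ω)) (fun b => g b)) :=
  fun _ _ _ _ _ _ _ _ _ _ _ _ P _ X Y => exists_elementary_condKernel P X Y

end Countable

end Summit.CriticalPhenomena.SAWScalingLimit.Theorems.AxiomsOfLimitMarkov

end
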